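import Summits.QuantumAdvantage.AdviceFreeQNC0.DualGenOutEightA
import Summits.QuantumAdvantage.AdviceFreeQNC0.DualGenOutEightB
import Summits.QuantumAdvantage.AdviceFreeQNC0.NearOutCorollaries
import HarnessLib

/-!
# Cell qa-qnc0 (rung F-Q1, density axis): `NearOutEight` — the near-outside MASS INEQUALITY at `m = 8`,
# unconditionally

Planner qa-qnc0-p1 Sketch13 v6c (`MassInequalityRegimes.lean`, ROUND-12 §2.10 (xi-o)): **MI(8) holds for every
deviation whose OUTSIDE rows are within distance `9` of `C_8`** — inside rows, ranks and weights unrestricted —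
at every symmetric optimum `K0` of `C_8` ("finite facts: SC₁(8), L = 6, d(C_8) = 58").  The chain in the kernel:

* `nearOutLemma` (qn-prover g8, `NearOutLemma.lean`) and its corollary `nearOutMass_of_isOpt1`
  (`NearOutCorollaries.lean`): at an optimal `K0`, `NearOutMass m ρ K0` follows from `DualGenOut m K0 L` and
  `pwt Q > max(failCount K0, L·ρ)` for every non-zero codeword `Q`;
* `SymCount.minWt_eight` (qn-lit g12, `SymmetricDistances.lean`): every non-zero codeword of `C_8` has weight
  `≥ 58 > max(45, 54)`; `SymCount.opt_eight` (`SymmetricUniqueness.lean`): the optima of `C_8` are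
  `symWord 8 true` and `symWordB 8` (`failCount = 45`);
* `dualGenOut_eight_A`, `dualGenOut_eight_B` (this seat, `DualGenOutEight{A,B}.lean`): `DualGenOut 8 K0 6` at
  both optima, by kernel-checked triangular short-word certificates (`DualGenCertificate.lean`).

WHAT THIS IS NOT: the far regime at `m = 8` (outside rows farther than `9` from `C_8`), unweighted MI(8) in
full, `MassIneqAll`, MULT₁ — all OPEN; nothing on α; separation NOT moved.
-/

namespace Summit.QuantumAdvantage.AdviceFreeQNC0

open Finset
open MassInequality SymCount

/-- `DualGenOut 8 K0 6` at every optimum of `C_8` (the two optima, by `opt_eight`). -/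
theorem dualGenOut_eight {K0 : (Fin 8 → Bool) → Bool} (hK : IsOpt1 8 K0) : DualGenOut 8 K0 6 := by
  rcases opt_eight hK with rfl | rfl
  · exact dualGenOut_eight_A
  · exact dualGenOut_eight_B

/-- **`NearOutEight` — PROVED**: at every (symmetric) optimum `K0` of `C_8`, the mass inequality
`0 ≤ bracket 8 K0 D` holds for every deviation `D` with codeword columns whose outside rows are within
distance `9` of `C_8`.  (The symmetry hypothesis is not used: `opt_eight` classifies all optima.) -/
theorem nearOutEight : NearOutEight := by
  intro K0 hK _
  refine nearOutMass_of_isOpt1 hK (dualGenOut_eight hK) fun Q hQ h0 => ?_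
  have h58 : 58 ≤ pwt Q := minWt_eight Q hQ h0
  have h45 : failCount K0 ≤ 45 := by
    have h := hK.2 _ (isElim1_symWord 8 true)
    rwa [failCount_symWord_eight] at h
  exact ⟨by omega, by omega⟩

end Summit.QuantumAdvantage.AdviceFreeQNC0
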